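import Literature.Probability.RandomPlanarGeometry.HexSAWStripWidthThreeHatContactAnnihilator
import HarnessLib

/-!
# The width-three strip: the CUBE-weighted contact hat sums `Ĉ³` of `S₃` obey the order-`24` recurrence of the bridge sums with explicit sources —
# `Σ_r t_rĈ³ + 3Σ_r ṫ_rĈ² + 3Σ_r ẗ_rĈ + Σ_r t⃛_rD̂ = 0` (module «WIDTH-THREE HAT THIRD CONTACT ANNIHILATOR»)

Topic `Literature/Probability/RandomPlanarGeometry` (continues «WIDTH-THREE HAT CONTACT ANNIHILATOR» `HexSAWStripWidthThreeHatContactAnnihilator.lean` —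
`W3.detY_contact_sq_annihilator` (`Σ t_rĈ² + 2Σ ṫ_rĈ + Σ ẗ_rD̂ = 0`), `W3.detYVec`, `W3.detY/detYDot/detYDDot` and their derivative plumbing — and the
`y∂_y` method of «WIDTH-THREE HAT CONTACT RECURSION» (`HV.hasDerivAt_LUs`, `HV.hasDerivAt_contactSum`, `HV.mul_derivContactSum_eq`)).  Lane «pcv-sawmu»
(CriticalPhenomena venture), a-p2 g29 — first step towards the THIRD contact cumulant `κ₃` of the critical width-three strip (PREREG Am. BO blind cell P-BO-1,
`κ₃ = −0.1096812271` per step, HIT by replication; kit `HOME/pub-sawmu-a-p2/g29/kit/kappa3_check.py` reproduces it from `det P` to 10 digits as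
`(L₃ − 3L₁L₂ + 2L₁³)/2`).  One more `y∂_y`: `y∂_yĈ² = Ĉ³`, `y∂_y ẗ_r = t⃛_r`.  Source of the frame: W. Feller I (1968) XIII.6; nothing below is printed.

## What is proved (namespace `…SAW.HV.W3`)
* §1 `hatC3D y k` (`Ĉ³(k)_{ab} = Σ #top³·x^{#steps}y^{#top}`), `hasDerivAt_contactSqSum_three`, `mul_derivContactSqSum_three_eq` (`y∂_y Σ#top²wD = Σ#top³wD`).
* §2 `detYPolyDDDot`, `detYDDDot` (`t⃛_r = (y∂_y)³t_r = x_c^{48−2r}Σ m³c_{r,m}y^m`), `hasDerivAt_detYPolyDDot`, `mul_deriv_detYPolyDDot`, `hasDerivAt_detYDDot`.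
* §3 ★★★ **`detY_contact_cube_annihilator`**: `Σ_{r<25} t_rĈ³(n+1+r)_{ab} + 3Σ ṫ_rĈ²(n+1+r)_{ab} + 3Σ ẗ_rĈ(n+1+r)_{ab} + Σ t⃛_rD̂(n+1+r)_{ab} = 0` (`y > 0`).

Label: LANE THEOREM (own result of lane «pcv-sawmu», a-p2 g29, 2026-08-28; not in print).  NOT claimed: the cubic law of `Ĉ³` and `κ₃` (next modules).
-/

noncomputable section

open Finset Filter Topology Matrix Literature.Probability.LatticeModels Literature.Probability.Percolation

namespace Literature.Probability.RandomPlanarGeometry.SAW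

namespace HV

namespace W3

/-! ## §1 The cube-weighted contact hat sums and `y∂_y Ĉ² = Ĉ³` -/

/-- The cube-weighted contact hat bridge sum of `S₃`: `Ĉ³(k)_{ab} = Σ_{standard bridges a→b with 2k+χ_a−χ_b steps} #top³ · x^{#steps} y^{#top}` (the third
factor of the third central moment). [cite: Feller1968, XIII.6; DuminilCopinHammond2013, §2.2; lane «pcv-sawmu» a-p2 g29] -/
def hatC3D (y : ℝ) (k : ℕ) : Matrix (Fin (2 * 3)) (Fin (2 * 3)) ℝ :=
  Matrix.of fun a b : Fin (2 * 3) => ∑ l ∈ LUset 3 (2 * k + 1) (hatLen k a b) (a : ℕ) (b : ℕ), (topCnt 3 l.tail : ℝ) ^ 3 * wD 3 y l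

/-- `k·y^{k−1}·y = k·y^k` for natural `k` (both sides vanish at `k = 0`; plumbing, private). [folklore] -/
private theorem natMul_pow_pred_mul_w3 (k : ℕ) (y : ℝ) : (k : ℝ) * y ^ (k - 1) * y = (k : ℝ) * y ^ k := by
  rcases Nat.eq_zero_or_pos k with h | h
  · subst h; simp
  · rw [mul_assoc, ← pow_succ, Nat.sub_add_cancel h]

/-- The square-weighted contact sum over a finite set of words is differentiable in `y` (plumbing). [cite: DuminilCopinHammond2013, §2.2; lane plumbing] -/
theorem hasDerivAt_contactSqSum_three (S : Finset (List HV)) (y : ℝ) :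
    HasDerivAt (fun y => ∑ l ∈ S, (topCnt 3 l.tail : ℝ) ^ 2 * wD 3 y l)
      (∑ l ∈ S, (topCnt 3 l.tail : ℝ) ^ 2 * (hexCriticalFugacity ^ (l.length - 1) * ((topCnt 3 l.tail : ℝ) * y ^ (topCnt 3 l.tail - 1)))) y := by
  unfold wD
  exact HasDerivAt.fun_sum fun l _ => ((hasDerivAt_pow _ y).const_mul _).const_mul _

/-- `y · ∂_y Σ #top²·wD = Σ #top³·wD` (plumbing). [cite: DuminilCopinHammond2013, §2.2; lane plumbing] -/
theorem mul_derivContactSqSum_three_eq (S : Finset (List HV)) (y : ℝ) :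
    y * ∑ l ∈ S, (topCnt 3 l.tail : ℝ) ^ 2 * (hexCriticalFugacity ^ (l.length - 1) * ((topCnt 3 l.tail : ℝ) * y ^ (topCnt 3 l.tail - 1))) =
      ∑ l ∈ S, (topCnt 3 l.tail : ℝ) ^ 3 * wD 3 y l := by
  rw [mul_sum]
  refine sum_congr rfl fun l _ => ?_
  unfold wD
  calc y * ((topCnt 3 l.tail : ℝ) ^ 2 * (hexCriticalFugacity ^ (l.length - 1) * ((topCnt 3 l.tail : ℝ) * y ^ (topCnt 3 l.tail - 1))))
      = (topCnt 3 l.tail : ℝ) ^ 2 * hexCriticalFugacity ^ (l.length - 1) * ((topCnt 3 l.tail : ℝ) * y ^ (topCnt 3 l.tail - 1) * y) := by ring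
    _ = _ := by rw [natMul_pow_pred_mul_w3]; ring

/-! ## §2 The third `y`-derivative data of `det P` -/

/-- `p⃛_r(y) = Σ_{m<8} m³·c_{r,m} y^m`. [cite: Feller1968, XIII.6; lane «pcv-sawmu» a-p2 g29] -/
def detYPolyDDDot (r : ℕ) (y : ℝ) : ℝ := ∑ m : Fin 8, ((m : ℕ) : ℝ) ^ 3 * detYVec r m * y ^ (m : ℕ)

/-- `t⃛_r(y) := (y∂_y)³ t_r(y) = x_c^{48−2r}·p⃛_r(y)`. [cite: Feller1968, XIII.6; lane «pcv-sawmu» a-p2 g29] -/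
def detYDDDot (y : ℝ) (r : ℕ) : ℝ := hexCriticalFugacity ^ (48 - 2 * r) * detYPolyDDDot r y

/-- `p̈_r` is differentiable with derivative `Σ_m m²·c_{r,m}·(m y^{m−1})` (plumbing). [cite: Feller1968, XIII.6; lane plumbing] -/
theorem hasDerivAt_detYPolyDDot (r : ℕ) (y : ℝ) :
    HasDerivAt (detYPolyDDot r) (∑ m : Fin 8, ((m : ℕ) : ℝ) ^ 2 * detYVec r m * (((m : ℕ) : ℝ) * y ^ ((m : ℕ) - 1))) y := by
  unfold detYPolyDDot
  exact HasDerivAt.fun_sum fun m _ => (hasDerivAt_pow (m : ℕ) y).const_mul _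

/-- `y·p̈_r′(y) = p⃛_r(y)` (plumbing). [cite: Feller1968, XIII.6; lane plumbing] -/
theorem mul_deriv_detYPolyDDot (r : ℕ) (y : ℝ) :
    y * ∑ m : Fin 8, ((m : ℕ) : ℝ) ^ 2 * detYVec r m * (((m : ℕ) : ℝ) * y ^ ((m : ℕ) - 1)) = detYPolyDDDot r y := by
  unfold detYPolyDDDot
  rw [Finset.mul_sum]
  refine Finset.sum_congr rfl fun m _ => ?_
  rcases Nat.eq_zero_or_pos (m : ℕ) with h | h
  · rw [h]; simp
  · calc y * (((m : ℕ) : ℝ) ^ 2 * detYVec r m * (((m : ℕ) : ℝ) * y ^ ((m : ℕ) - 1)))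
        = ((m : ℕ) : ℝ) ^ 3 * detYVec r m * (y * y ^ ((m : ℕ) - 1)) := by ring
      _ = ((m : ℕ) : ℝ) ^ 3 * detYVec r m * y ^ (m : ℕ) := by rw [← pow_succ', Nat.sub_add_cancel h]

/-- `ẗ_r` is differentiable in `y` and `y·ẗ_r′ = t⃛_r` (plumbing). [cite: Feller1968, XIII.6; lane plumbing] -/
theorem hasDerivAt_detYDDot (y : ℝ) (r : ℕ) : ∃ d : ℝ, HasDerivAt (fun y => detYDDot y r) d y ∧ y * d = detYDDDot y r := by
  refine ⟨hexCriticalFugacity ^ (48 - 2 * r) * ∑ m : Fin 8, ((m : ℕ) : ℝ) ^ 2 * detYVec r m * (((m : ℕ) : ℝ) * y ^ ((m : ℕ) - 1)), ?_, ?_⟩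
  · unfold detYDDot; exact (hasDerivAt_detYPolyDDot r y).const_mul _
  · unfold detYDDDot; rw [← mul_deriv_detYPolyDDot]; ring

/-! ## §3 The third contact annihilator -/

/-- ★★★ **The third contact annihilator**: for `y > 0`, all levels `a, b` and all `n`,
`Σ_{r<25} t_r(y)Ĉ³(n+1+r)_{ab} + 3Σ_r ṫ_r(y)Ĉ²(n+1+r)_{ab} + 3Σ_r ẗ_r(y)Ĉ(n+1+r)_{ab} + Σ_r t⃛_r(y)D̂(n+1+r)_{ab} = 0` — `y∂_y` of `detY_contact_sq_annihilator`
(`y∂_yĈ² = Ĉ³`, `y∂_yĈ = Ĉ²`, `y∂_yD̂ = Ĉ`, `y∂_y t = ṫ`, `y∂_y ṫ = ẗ`, `y∂_y ẗ = t⃛`; binomial pattern `1, 3, 3, 1`).  This closes the linear system for the first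
THREE contact moments of long `S₃` bridges.
[cite: Feller1968, XIII.6 (moments of the number of renewals by differentiating the renewal equation); Stanley2012EC1, §4.1 Theorem 4.1.1 (iii); lane «pcv-sawmu» a-p2 g29 — own result, not in print] -/
theorem detY_contact_cube_annihilator {y : ℝ} (hy : 0 < y) (a b : Fin (2 * 3)) (n : ℕ) :
    ∑ r ∈ range 25, detY y r * hatC3D y (n + 1 + r) a b + 3 * ∑ r ∈ range 25, detYDot y r * hatC2D y (n + 1 + r) a b
      + 3 * ∑ r ∈ range 25, detYDDot y r * hatCD y (n + 1 + r) a b + ∑ r ∈ range 25, detYDDDot y r * hatD 3 y (n + 1 + r) a b = 0 := by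
  -- derivative data of the four slice families
  set dU : ℕ → ℝ → ℝ := fun k y =>
    ∑ l ∈ LUset 3 (2 * k + 1) (hatLen k a b) (a : ℕ) (b : ℕ), hexCriticalFugacity ^ (l.length - 1) * ((topCnt 3 l.tail : ℝ) * y ^ (topCnt 3 l.tail - 1))
    with hdU
  set dC : ℕ → ℝ → ℝ := fun k y =>
    ∑ l ∈ LUset 3 (2 * k + 1) (hatLen k a b) (a : ℕ) (b : ℕ),
      (topCnt 3 l.tail : ℝ) * (hexCriticalFugacity ^ (l.length - 1) * ((topCnt 3 l.tail : ℝ) * y ^ (topCnt 3 l.tail - 1))) with hdC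
  set dC2 : ℕ → ℝ → ℝ := fun k y =>
    ∑ l ∈ LUset 3 (2 * k + 1) (hatLen k a b) (a : ℕ) (b : ℕ),
      (topCnt 3 l.tail : ℝ) ^ 2 * (hexCriticalFugacity ^ (l.length - 1) * ((topCnt 3 l.tail : ℝ) * y ^ (topCnt 3 l.tail - 1))) with hdC2
  have hD : ∀ k (y : ℝ), HasDerivAt (fun y => hatD 3 y k a b) (dU k y) y := fun k y => hasDerivAt_LUs (2 * k + 1) (hatLen k a b) _ _ y
  have hC : ∀ k (y : ℝ), HasDerivAt (fun y => hatCD y k a b) (dC k y) y := fun k y => by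
    simp only [hatCD, Matrix.of_apply]; exact hasDerivAt_contactSum _ y
  have hC2d : ∀ k (y : ℝ), HasDerivAt (fun y => hatC2D y k a b) (dC2 k y) y := fun k y => by
    simp only [hatC2D, Matrix.of_apply]; exact hasDerivAt_contactSqSum_three _ y
  have hU : ∀ k, y * dU k y = hatCD y k a b := fun k => by
    rw [hdU]; simp only [hatCD, Matrix.of_apply]; exact mul_derivSum_eq_contactSum _ y
  have hC2 : ∀ k, y * dC k y = hatC2D y k a b := fun k => by
    rw [hdC]; simp only [hatC2D, Matrix.of_apply]; exact mul_derivContactSum_eq _ y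
  have hC3 : ∀ k, y * dC2 k y = hatC3D y k a b := fun k => by
    rw [hdC2]; simp only [hatC3D, Matrix.of_apply]; exact mul_derivContactSqSum_three_eq _ y
  choose dT hdT hTdot using fun r => hasDerivAt_detY y r
  choose dTd hdTd hTddot using fun r => hasDerivAt_detYDot y r
  choose dTdd hdTdd hTdddot using fun r => hasDerivAt_detYDDot y r
  set F : ℝ → ℝ := fun y => ∑ r ∈ range 25, detY y r * hatC2D y (n + 1 + r) a b + 2 * ∑ r ∈ range 25, detYDot y r * hatCD y (n + 1 + r) a b
      + ∑ r ∈ range 25, detYDDot y r * hatD 3 y (n + 1 + r) a b with hF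
  have hFd : HasDerivAt F (∑ r ∈ range 25, (dT r * hatC2D y (n + 1 + r) a b + detY y r * dC2 (n + 1 + r) y)
      + 2 * ∑ r ∈ range 25, (dTd r * hatCD y (n + 1 + r) a b + detYDot y r * dC (n + 1 + r) y)
      + ∑ r ∈ range 25, (dTdd r * hatD 3 y (n + 1 + r) a b + detYDDot y r * dU (n + 1 + r) y)) y := by
    rw [hF]
    exact ((HasDerivAt.fun_sum fun r _ => (hdT r).mul (hC2d (n + 1 + r) y)).add
      ((HasDerivAt.fun_sum fun r _ => (hdTd r).mul (hC (n + 1 + r) y)).const_mul 2)).add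
      (HasDerivAt.fun_sum fun r _ => (hdTdd r).mul (hD (n + 1 + r) y))
  have hF0 : F =ᶠ[𝓝 y] fun _ => (0 : ℝ) := by
    filter_upwards [Ioi_mem_nhds hy] with y' hy'
    rw [hF]
    exact detY_contact_sq_annihilator hy' a b n
  have hzero : ∑ r ∈ range 25, (dT r * hatC2D y (n + 1 + r) a b + detY y r * dC2 (n + 1 + r) y)
      + 2 * ∑ r ∈ range 25, (dTd r * hatCD y (n + 1 + r) a b + detYDot y r * dC (n + 1 + r) y)
      + ∑ r ∈ range 25, (dTdd r * hatD 3 y (n + 1 + r) a b + detYDDot y r * dU (n + 1 + r) y) = 0 :=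
    (hFd.congr_of_eventuallyEq hF0.symm).unique (hasDerivAt_const y (0 : ℝ))
  have hmul : y * (∑ r ∈ range 25, (dT r * hatC2D y (n + 1 + r) a b + detY y r * dC2 (n + 1 + r) y)
      + 2 * ∑ r ∈ range 25, (dTd r * hatCD y (n + 1 + r) a b + detYDot y r * dC (n + 1 + r) y)
      + ∑ r ∈ range 25, (dTdd r * hatD 3 y (n + 1 + r) a b + detYDDot y r * dU (n + 1 + r) y))
      = ∑ r ∈ range 25, detY y r * hatC3D y (n + 1 + r) a b + 3 * ∑ r ∈ range 25, detYDot y r * hatC2D y (n + 1 + r) a b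
        + 3 * ∑ r ∈ range 25, detYDDot y r * hatCD y (n + 1 + r) a b + ∑ r ∈ range 25, detYDDDot y r * hatD 3 y (n + 1 + r) a b := by
    rw [mul_add, mul_add, ← mul_assoc y 2, mul_comm y 2, mul_assoc 2 y, Finset.mul_sum, Finset.mul_sum, Finset.mul_sum, Finset.mul_sum,
      Finset.mul_sum, Finset.mul_sum, ← Finset.sum_add_distrib, ← Finset.sum_add_distrib, ← Finset.sum_add_distrib, ← Finset.sum_add_distrib,
      ← Finset.sum_add_distrib]
    refine Finset.sum_congr rfl fun r _ => ?_
    rw [← hU (n + 1 + r), ← hC2 (n + 1 + r), ← hC3 (n + 1 + r), ← hTdot r, ← hTddot r, ← hTdddot r]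
    ring
  rw [← hmul, hzero, mul_zero]

end W3

end HV

end Literature.Probability.RandomPlanarGeometry.SAW
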